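import Mathlib
import Summits.AtomisticToContinuum.HydrodynamicLimit.Theorems.InformationPercolationEngineKickFairRelEquilibriumMesoConditionThePastDefs
import Summits.AtomisticToContinuum.HydrodynamicLimit.Theorems.InformationPercolationEngineKickFairRelEquilibriumMesoReductionBSetup
import Literature.MathematicalPhysics.KineticTheory.LocalGibbsConstEquivalence
import HarnessLib

/-!
# `KickFairRelEquilibriumMeso`, line `condition-the-past` — stub Red-B, part 2: `stub_reductionB`

File of the line lead (c7) proving the registered stub
`stub_reductionB : PairExpansion → PairInnovationBias rs → UnorderedPairWeight rs → TruncatedFluctuation rs` of the skeleton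
`Cruxes/KickFairRelEquilibriumMeso/Lines/condition_the_past.lean` (rev 2), on top of part 1 (`…MesoReductionBSetup`: the finite
family `pastSA`/`pairSA`/`wt`/`validEv`/`ordEv` over `Fin (N+1) × Fin (idxCut A N)`, the hypotheses of `PairExpansion` for it, and
the a.e. identification `truncSum_ae_eq` of the truncated fluctuation sum with the weighted centred family sum). Argument: under
the local Gibbs law (a probability measure for `σ ≤ 1/2`) apply `PairExpansion` (bound `B = 2C`); Cauchy–Schwarz
`(c ∫|S|)² ≤ c² ∫ S² ≤ 4B (c² X) + 4B² (c² Y)`; on the a.e. set where the cut is genuine (`n < cnt_i ↔ t_{i,n} ∈ (0, τ]`) the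
ordered-pair sum `X` and the unordered-pair count `Y` of the truncated family are dominated pointwise by the B2′ / CT-b integrands
(drop the truncation, nonnegative terms), so `c² X ≤ δ²/(16C+1)`, `c² Y ≤ δ²/(32C²+1)` eventually, whence `c ∫|S| ≤ δ`.
-/

noncomputable section

open MeasureTheory Set Filter Topology
open scoped ENNReal Classical

namespace Summit.AtomisticToContinuum.HydrodynamicLimit.Theorems.KickFairRelEquilibriumMesoLine

open Literature.Analysis.FluidPDE Literature.MathematicalPhysics.KineticTheory

variable {σ : ℝ} {N : ℕ}

/-! ## Generic lemmas -/

section Generic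

variable {Ω : Type*} [MeasurableSpace Ω] {μ : Measure Ω}

/-- `(∫ |f|)² ≤ ∫ f²` on a probability space (variance of `|f|` is nonnegative). [folklore] -/
theorem sq_integral_abs_le_integral_sq [IsProbabilityMeasure μ] {f : Ω → ℝ} (hf : Integrable f μ)
    (hf2 : Integrable (fun x => f x ^ 2) μ) : (∫ x, |f x| ∂μ) ^ 2 ≤ ∫ x, f x ^ 2 ∂μ := by
  set m := ∫ x, |f x| ∂μ with hm
  have h0 : 0 ≤ ∫ x, (|f x| - m) ^ 2 ∂μ := integral_nonneg fun x => sq_nonneg _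
  have hexp : ∀ x, (|f x| - m) ^ 2 = (f x ^ 2 - 2 * m * |f x|) + m ^ 2 := fun x => by
    rw [sub_sq, sq_abs]; ring
  have hi1 : Integrable (fun x => 2 * m * |f x|) μ := hf.abs.const_mul _
  have hi2 : Integrable (fun x => f x ^ 2 - 2 * m * |f x|) μ := hf2.sub hi1
  have hcalc : ∫ x, (|f x| - m) ^ 2 ∂μ = ∫ x, f x ^ 2 ∂μ - m ^ 2 := by
    simp_rw [hexp]
    rw [integral_add hi2 (integrable_const _), integral_sub hf2 hi1, integral_const_mul, integral_const,
      smul_eq_mul, probReal_univ, one_mul]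
    ring
  linarith

/-- From `lintegral` to `integral`: if `0 ≤ F ≤ G` a.e., `F` a.e.-strongly measurable and `∫⁻ ofReal G ≤ ofReal d`
with `0 ≤ d`, then `∫ F ≤ d` (no measurability of `G` needed). [folklore] -/
theorem integral_le_of_lintegral_ofReal_le {F G : Ω → ℝ} {d : ℝ} (hF0 : 0 ≤ᵐ[μ] F)
    (hFm : AEStronglyMeasurable F μ) (hFG : ∀ᵐ x ∂μ, F x ≤ G x)
    (hG : ∫⁻ x, ENNReal.ofReal (G x) ∂μ ≤ ENNReal.ofReal d) (hd : 0 ≤ d) : ∫ x, F x ∂μ ≤ d := by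
  rw [integral_eq_lintegral_of_nonneg_ae hF0 hFm]
  have h1 : ∫⁻ x, ENNReal.ofReal (F x) ∂μ ≤ ENNReal.ofReal d :=
    (lintegral_mono_ae (hFG.mono fun x hx => ENNReal.ofReal_le_ofReal hx)).trans hG
  calc (∫⁻ x, ENNReal.ofReal (F x) ∂μ).toReal ≤ (ENNReal.ofReal d).toReal :=
        ENNReal.toReal_mono ENNReal.ofReal_ne_top h1
    _ = d := ENNReal.toReal_ofReal hd

/-- A bounded a.e., a.e.-strongly measurable real function on a finite measure space is integrable. [folklore] -/
theorem integrable_of_ae_abs_le [IsFiniteMeasure μ] {f : Ω → ℝ} (hfm : AEStronglyMeasurable f μ) {B : ℝ}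
    (hfb : ∀ᵐ x ∂μ, |f x| ≤ B) : Integrable f μ :=
  Integrable.of_bound hfm B (hfb.mono fun x hx => by simpa [Real.norm_eq_abs] using hx)

end Generic

/-- **Dropping the truncation**: for nonnegative `S` and any counts `cnt`,
`Σ_i Σ_{n<M} Σ_{i'} Σ_{n'<M} 1_{n<cnt_i} 1_{n'<cnt_{i'}} S ≤ Σ_i Σ_{n<cnt_i} Σ_{i'} Σ_{n'<cnt_{i'}} S`. [folklore] -/
theorem sum_cut_trunc_le {ι : Type*} [Fintype ι] (cnt : ι → ℕ) (M : ℕ) (S : ι → ℕ → ι → ℕ → ℝ)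
    (hS : ∀ i n i' n', 0 ≤ S i n i' n') :
    ∑ i, ∑ n ∈ Finset.range M, ∑ i', ∑ n' ∈ Finset.range M,
        (if n < cnt i then (1 : ℝ) else 0) * ((if n' < cnt i' then (1 : ℝ) else 0) * S i n i' n') ≤
      ∑ i, ∑ n ∈ Finset.range (cnt i), ∑ i', ∑ n' ∈ Finset.range (cnt i'), S i n i' n' := by
  have inner : ∀ i n, ∑ i', ∑ n' ∈ Finset.range M, (if n' < cnt i' then (1 : ℝ) else 0) * S i n i' n' ≤
      ∑ i', ∑ n' ∈ Finset.range (cnt i'), S i n i' n' := by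
    intro i n
    refine Finset.sum_le_sum fun i' _ => ?_
    rw [sum_range_ite_lt_comm (fun n' => S i n i' n') M (cnt i')]
    refine Finset.sum_le_sum fun n' _ => ?_
    have h0 := hS i n i' n'
    split_ifs <;> nlinarith
  have inner0 : ∀ i n, 0 ≤ ∑ i', ∑ n' ∈ Finset.range M, (if n' < cnt i' then (1 : ℝ) else 0) * S i n i' n' :=
    fun i n => Finset.sum_nonneg fun i' _ => Finset.sum_nonneg fun n' _ => by
      have h0 := hS i n i' n'
      split_ifs <;> nlinarith
  refine Finset.sum_le_sum fun i _ => ?_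
  simp_rw [← Finset.mul_sum]
  rw [sum_range_ite_lt_comm (fun n => ∑ i', ∑ n' ∈ Finset.range M,
    (if n' < cnt i' then (1 : ℝ) else 0) * S i n i' n') M (cnt i)]
  refine Finset.sum_le_sum fun n _ => ?_
  have h1 := inner i n
  have h2 := inner0 i n
  split_ifs <;> nlinarith

/-- `sum_cut_trunc_le` with the truncated indices packed into `ι × Fin M` (the index type of the finite family). [folklore] -/
theorem sum_prod_fin_cut_le {ι : Type*} [Fintype ι] (cnt : ι → ℕ) (M : ℕ) (S : ι → ℕ → ι → ℕ → ℝ)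
    (hS : ∀ i n i' n', 0 ≤ S i n i' n') :
    ∑ k : ι × Fin M, ∑ l : ι × Fin M, (if (k.2 : ℕ) < cnt k.1 then (1 : ℝ) else 0) *
        ((if (l.2 : ℕ) < cnt l.1 then (1 : ℝ) else 0) * S k.1 k.2 l.1 l.2) ≤
      ∑ i, ∑ n ∈ Finset.range (cnt i), ∑ i', ∑ n' ∈ Finset.range (cnt i'), S i n i' n' := by
  refine le_trans (le_of_eq ?_) (sum_cut_trunc_le cnt M S hS)
  rw [Fintype.sum_prod_type]
  refine Finset.sum_congr rfl fun i _ => ?_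
  rw [Fin.sum_univ_eq_sum_range (fun n => ∑ l : ι × Fin M, (if n < cnt i then (1 : ℝ) else 0) *
      ((if (l.2 : ℕ) < cnt l.1 then (1 : ℝ) else 0) * S i n l.1 l.2)) M]
  refine Finset.sum_congr rfl fun n _ => ?_
  rw [Fintype.sum_prod_type]
  refine Finset.sum_congr rfl fun i' _ => ?_
  rw [Fin.sum_univ_eq_sum_range (fun n' => (if n < cnt i then (1 : ℝ) else 0) *
      ((if n' < cnt i' then (1 : ℝ) else 0) * S i n i' n')) M]

/-! ## The registered stub -/

section Main

variable {a₀ θ₀ : T3 → ℝ} {u₀ : T3 → V3}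

/-- `|β_{i,n}| ≤ 2C` for all `i, n`, `LG`-a.e. (conditional expectation of an a.e. bounded function). [folklore] -/
theorem ae_forall_abs_betaLG_le (hσ2 : σ ≤ 1 / 2) (Φ : Flow σ N) (r : ℝ) {g : V3 × V3 × V3 → ℝ} {C : ℝ}
    (hg : ∀ p, |g p| ≤ C) :
    ∀ᵐ z ∂(localGibbsLaw σ a₀ u₀ θ₀ N Φ), ∀ i : Fin (N + 1), ∀ n : ℕ, |betaLG σ a₀ θ₀ u₀ Φ r g i n z| ≤ 2 * C :=
  ae_all_iff.2 fun i => ae_all_iff.2 fun n => ae_bdd_abs_condExp_of_ae_bdd_abs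
    ((ae_forall_abs_kickDev_le (a₀ := a₀) (θ₀ := θ₀) (u₀ := u₀) hσ2 Φ r hg).mono fun _ hz => hz i n)

/-- `|β₂| ≤ 2C` for all index pairs, `LG`-a.e. [folklore] -/
theorem ae_forall_abs_betaLG2_le (hσ2 : σ ≤ 1 / 2) (Φ : Flow σ N) (r : ℝ) {g : V3 × V3 × V3 → ℝ} {C : ℝ}
    (hg : ∀ p, |g p| ≤ C) :
    ∀ᵐ z ∂(localGibbsLaw σ a₀ u₀ θ₀ N Φ), ∀ i : Fin (N + 1), ∀ n : ℕ, ∀ i' : Fin (N + 1), ∀ n' : ℕ,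
      |betaLG2 σ a₀ θ₀ u₀ Φ r g i n i' n' z| ≤ 2 * C :=
  ae_all_iff.2 fun _ => ae_all_iff.2 fun _ => ae_all_iff.2 fun i' => ae_all_iff.2 fun n' =>
    ae_bdd_abs_condExp_of_ae_bdd_abs
      ((ae_forall_abs_kickDev_le (a₀ := a₀) (θ₀ := θ₀) (u₀ := u₀) hσ2 Φ r hg).mono fun _ hz => hz i' n')

/-- `betaLG` is Borel measurable. [folklore] -/
theorem measurable_betaLG_borel (Φ : Flow σ N) (r : ℝ) (g : V3 × V3 × V3 → ℝ) (i : Fin (N + 1)) (n : ℕ) :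
    Measurable (betaLG σ a₀ θ₀ u₀ Φ r g i n) :=
  (stronglyMeasurable_condExp.measurable).mono (pastSA_le Φ r i n) le_rfl

/-- `betaLG2` is Borel measurable. [folklore] -/
theorem measurable_betaLG2 (Φ : Flow σ N) (r : ℝ) {g : V3 × V3 × V3 → ℝ} (hg : Continuous g)
    (i : Fin (N + 1)) (n : ℕ) (i' : Fin (N + 1)) (n' : ℕ) :
    Measurable (betaLG2 σ a₀ θ₀ u₀ Φ r g i n i' n') :=
  (stronglyMeasurable_condExp.measurable).mono (pairSA_le Φ r hg i n i' n') le_rfl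

/-- `wt` is Borel measurable. [folklore] -/
theorem measurable_wt (Φ : Flow σ N) (τ r : ℝ) {h : Fin (N + 1) → ℕ → Past N → ℝ}
    (hh : ∀ i n, Measurable (h i n)) (i : Fin (N + 1)) (n : ℕ) : Measurable (wt Φ τ r h i n) :=
  (measurable_wtFun τ hh i n).comp (measurable_past Φ r i n)

/-- `|wt| ≤ 1`. [folklore] -/
theorem abs_wt_le_one (Φ : Flow σ N) (τ r : ℝ) {h : Fin (N + 1) → ℕ → Past N → ℝ} (hhb : ∀ i n p, |h i n p| ≤ 1)
    (i : Fin (N + 1)) (n : ℕ) (z : Phase N) : |wt Φ τ r h i n z| ≤ 1 :=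
  (abs_wt_le Φ r τ hhb i n z).trans (Set.indicator_le_self' (fun _ _ => zero_le_one) z)

/-- The validity and order events are Borel. [folklore] -/
theorem measurableSet_validEv_borel (Φ : Flow σ N) (τ r : ℝ) (i : Fin (N + 1)) (n : ℕ) :
    MeasurableSet (validEv Φ τ r i n) :=
  pastSA_le Φ r i n _ (measurableSet_validEv Φ r τ i n)

/-- See `measurableSet_validEv_borel`. [folklore] -/
theorem measurableSet_ordEv_borel (Φ : Flow σ N) (r : ℝ) {g : V3 × V3 × V3 → ℝ} (hg : Continuous g)
    (i : Fin (N + 1)) (n : ℕ) (i' : Fin (N + 1)) (n' : ℕ) : MeasurableSet (ordEv Φ r i n i' n') :=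
  pairSA_le Φ r hg i n i' n' _ (measurableSet_ordEv Φ r g i n i' n')

/-- **Pointwise comparison, ordered pairs**: where the cut is genuine, the ordered-pair sum of `PairExpansion` over
the truncated family is dominated by the B2′ pair sum (drop the truncation; nonnegative terms). [folklore] -/
theorem pairSum_ordered_le (Φ : Flow σ N) (τ r : ℝ) (g : V3 × V3 × V3 → ℝ) (M : ℕ) {z : Phase N}
    (hz : ∀ (i : Fin (N + 1)) (n : ℕ), n < cnt Φ τ z i ↔ (past Φ r z i n).2.2.2 ∈ Set.Ioc 0 τ) :
    ∑ k : Fin (N + 1) × Fin M, ∑ l : Fin (N + 1) × Fin M,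
        (validEv Φ τ r k.1 k.2 ∩ validEv Φ τ r l.1 l.2 ∩ ordEv Φ r k.1 k.2 l.1 l.2).indicator
            (fun _ => (1 : ℝ)) z *
          |betaLG2 σ a₀ θ₀ u₀ Φ r g k.1 k.2 l.1 l.2 z - betaLG σ a₀ θ₀ u₀ Φ r g l.1 l.2 z| ≤
      ∑ i : Fin (N + 1), ∑ n ∈ Finset.range (cnt Φ τ z i),
        ∑ i' : Fin (N + 1), ∑ n' ∈ Finset.range (cnt Φ τ z i'),
          (if Precedes (past Φ r z i n) (past Φ r z i' n') then (1 : ℝ) else 0) *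
            |betaLG2 σ a₀ θ₀ u₀ Φ r g i n i' n' z - betaLG σ a₀ θ₀ u₀ Φ r g i' n' z| := by
  refine le_trans (le_of_eq (Fintype.sum_congr _ _ fun k => Fintype.sum_congr _ _ fun l => ?_))
    (sum_prod_fin_cut_le (cnt Φ τ z) M (fun i n i' n' =>
      (if Precedes (past Φ r z i n) (past Φ r z i' n') then (1 : ℝ) else 0) *
        |betaLG2 σ a₀ θ₀ u₀ Φ r g i n i' n' z - betaLG σ a₀ θ₀ u₀ Φ r g i' n' z|) fun _ _ _ _ => by positivity)
  by_cases hk : (past Φ r z k.1 k.2).2.2.2 ∈ Set.Ioc 0 τ <;>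
    by_cases hl : (past Φ r z l.1 l.2).2.2.2 ∈ Set.Ioc 0 τ <;>
      by_cases hp : Precedes (past Φ r z k.1 k.2) (past Φ r z l.1 l.2) <;>
        simp only [validEv, ordEv, Set.indicator_apply, Set.mem_inter_iff, Set.mem_preimage, Set.mem_setOf_eq,
          hz, hk, hl, hp, and_true, and_false, and_self, if_true, if_false, one_mul, zero_mul]

/-- **Pointwise comparison, unordered pairs**: where the cut is genuine, the unordered-pair count of `PairExpansion`
over the truncated family is dominated by the CT-b pair count. [folklore] -/
theorem pairSum_unordered_le (Φ : Flow σ N) (τ r : ℝ) (M : ℕ) {z : Phase N}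
    (hz : ∀ (i : Fin (N + 1)) (n : ℕ), n < cnt Φ τ z i ↔ (past Φ r z i n).2.2.2 ∈ Set.Ioc 0 τ) :
    ∑ k : Fin (N + 1) × Fin M, ∑ l : Fin (N + 1) × Fin M,
        (validEv Φ τ r k.1 k.2 ∩ validEv Φ τ r l.1 l.2 ∩ (ordEv Φ r k.1 k.2 l.1 l.2)ᶜ ∩
            (ordEv Φ r l.1 l.2 k.1 k.2)ᶜ).indicator (fun _ => (1 : ℝ)) z ≤
      ∑ i : Fin (N + 1), ∑ n ∈ Finset.range (cnt Φ τ z i),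
        ∑ i' : Fin (N + 1), ∑ n' ∈ Finset.range (cnt Φ τ z i'),
          (if ¬ Precedes (past Φ r z i n) (past Φ r z i' n') ∧
              ¬ Precedes (past Φ r z i' n') (past Φ r z i n) then (1 : ℝ) else 0) := by
  refine le_trans (le_of_eq (Fintype.sum_congr _ _ fun k => Fintype.sum_congr _ _ fun l => ?_))
    (sum_prod_fin_cut_le (cnt Φ τ z) M (fun i n i' n' =>
      (if ¬ Precedes (past Φ r z i n) (past Φ r z i' n') ∧
          ¬ Precedes (past Φ r z i' n') (past Φ r z i n) then (1 : ℝ) else 0)) fun _ _ _ _ => by positivity)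
  by_cases hk : (past Φ r z k.1 k.2).2.2.2 ∈ Set.Ioc 0 τ <;>
    by_cases hl : (past Φ r z l.1 l.2).2.2.2 ∈ Set.Ioc 0 τ <;>
      by_cases hp : Precedes (past Φ r z k.1 k.2) (past Φ r z l.1 l.2) <;>
        by_cases hq : Precedes (past Φ r z l.1 l.2) (past Φ r z k.1 k.2) <;>
          simp only [validEv, ordEv, Set.indicator_apply, Set.mem_inter_iff, Set.mem_compl_iff, Set.mem_preimage,
            Set.mem_setOf_eq, hz, hk, hl, hp, hq, and_true, and_false, and_self, if_true, if_false, mul_one,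
            mul_zero, not_true_eq_false, not_false_eq_true]

/-- `8C δ²/(16C+1) + 16C² δ²/(32C²+1) ≤ δ²` (the choice of the B2′ and CT-b targets). [folklore] -/
theorem targets_le_sq {C δ : ℝ} (hC : 0 ≤ C) :
    4 * (2 * C) * (δ ^ 2 / (16 * C + 1)) + 4 * (2 * C) ^ 2 * (δ ^ 2 / (32 * C ^ 2 + 1)) ≤ δ ^ 2 := by
  have h1 : 4 * (2 * C) * (δ ^ 2 / (16 * C + 1)) ≤ δ ^ 2 / 2 := by
    rw [← mul_div_assoc, div_le_div_iff₀ (by positivity) (by positivity)]; nlinarith [sq_nonneg δ]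
  have h2 : 4 * (2 * C) ^ 2 * (δ ^ 2 / (32 * C ^ 2 + 1)) ≤ δ ^ 2 / 2 := by
    rw [← mul_div_assoc, div_le_div_iff₀ (by positivity) (by positivity)]; nlinarith [sq_nonneg δ, sq_nonneg C]
  linarith

/-- **STUB Red-B `stub_reductionB` — second half of the reduction.** From the abstract pair expansion (PE), the pair
innovation bound (B2′) and the unordered pair count (CT-b), the truncated fluctuation bound (TF): instantiate PE on the
finite family of `…MesoReductionBSetup` under the local Gibbs law (a probability measure for `σ ≤ 1/2`), identify the
truncated sum with the weighted centred family sum a.e. (`truncSum_ae_eq`), Cauchy–Schwarz, and compare the two finite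
pair sums with the B2′ / CT-b integrands pointwise a.e. (nonnegative terms, genuine cut) in the `lintegral` currency. [folklore] -/
theorem stub_reductionB : PairExpansion → PairInnovationBias rs → UnorderedPairWeight rs → TruncatedFluctuation rs := by
  intro hPE hB2 hCb a₀ θ₀ u₀ ha hθ hu ha0 hθ0
  obtain ⟨σ₁, hσ₁, H2⟩ := hB2 a₀ θ₀ u₀ ha hθ hu ha0 hθ0
  obtain ⟨σ₂, hσ₂, Hb⟩ := hCb a₀ θ₀ u₀ ha hθ hu ha0 hθ0
  refine ⟨min (min σ₁ σ₂) (1 / 2), lt_min (lt_min hσ₁ hσ₂) (by norm_num), ?_⟩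
  intro σ hσ hσlt Φ τ hτ g hg hgb A hA δ hδ
  obtain ⟨C, hC⟩ := hgb
  have hσ1' : σ < σ₁ := hσlt.trans_le ((min_le_left _ _).trans (min_le_left _ _))
  have hσ2' : σ < σ₂ := hσlt.trans_le ((min_le_left _ _).trans (min_le_right _ _))
  have hσ2 : σ ≤ 1 / 2 := (hσlt.trans_le (min_le_right _ _)).le
  have hC0 : 0 ≤ C := (abs_nonneg _).trans (hC 0)
  -- the targets for B2′ and CT-b
  set δ₂ : ℝ := δ ^ 2 / (16 * C + 1) with hδ₂
  set δb : ℝ := δ ^ 2 / (32 * C ^ 2 + 1) with hδb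
  have hδ₂0 : 0 < δ₂ := by positivity
  have hδb0 : 0 < δb := by positivity
  obtain ⟨N₁, hN₁⟩ := H2 σ hσ hσ1' Φ τ hτ g hg ⟨C, hC⟩ δ₂ hδ₂0
  obtain ⟨N₂, hN₂⟩ := Hb σ hσ hσ2' Φ τ hτ δb hδb0
  refine ⟨max N₁ N₂, fun N hN h hhm hhb => ?_⟩
  have hB2N := hN₁ N (le_of_max_le_left hN)
  have hCbN := hN₂ N (le_of_max_le_right hN)
  set LG := localGibbsLaw σ a₀ u₀ θ₀ N (Φ N) with hLG
  haveI : IsProbabilityMeasure LG := isProbabilityMeasure_localGibbsLaw ha hθ hu ha0 hθ0 hσ2 N (Φ N)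
  set c : ℝ := hsDiameter σ N / ((N : ℝ) + 1) with hc
  have hc0 : 0 ≤ c := div_nonneg (hsDiameter_pos hσ N).le (by positivity)
  set M : ℕ := idxCut A N with hM
  set r : ℝ := rs N with hr
  set β : Fin (N + 1) → ℕ → Phase N → ℝ := fun i n => betaLG σ a₀ θ₀ u₀ (Φ N) r g i n with hβ
  set β₂ : Fin (N + 1) → ℕ → Fin (N + 1) → ℕ → Phase N → ℝ :=
    fun i n i' n' => betaLG2 σ a₀ θ₀ u₀ (Φ N) r g i n i' n' with hβ₂
  set D : Fin (N + 1) → ℕ → Phase N → ℝ := fun i n => kickDev (Φ N) r g i n with hD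
  set w : Fin (N + 1) → ℕ → Phase N → ℝ := fun i n => wt (Φ N) τ r h i n with hw
  set Sf : Phase N → ℝ := fun z => ∑ k : Fin (N + 1) × Fin M, w k.1 k.2 z * (D k.1 k.2 z - β k.1 k.2 z) with hSf
  have haeD := ae_forall_abs_kickDev_le (a₀ := a₀) (θ₀ := θ₀) (u₀ := u₀) hσ2 (Φ N) r hC
  have haeβ := ae_forall_abs_betaLG_le (a₀ := a₀) (θ₀ := θ₀) (u₀ := u₀) hσ2 (Φ N) r hC
  have haeβ₂ := ae_forall_abs_betaLG2_le (a₀ := a₀) (θ₀ := θ₀) (u₀ := u₀) hσ2 (Φ N) r hC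
  have haecut := ae_forall_lt_cnt_iff_pastTime (a₀ := a₀) (θ₀ := θ₀) (u₀ := u₀) hσ2 (Φ N) τ r
  -- Step 1: the abstract pair expansion for the family
  have hPEapp : ∫ z, Sf z ^ 2 ∂LG ≤
      4 * (2 * C) * ∑ k : Fin (N + 1) × Fin M, ∑ l : Fin (N + 1) × Fin M,
        (∫ z, (validEv (Φ N) τ r k.1 k.2 ∩ validEv (Φ N) τ r l.1 l.2 ∩ ordEv (Φ N) r k.1 k.2 l.1 l.2).indicator
            (fun _ => (1 : ℝ)) z * |β₂ k.1 k.2 l.1 l.2 z - β l.1 l.2 z| ∂LG) +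
      4 * (2 * C) ^ 2 * ∑ k : Fin (N + 1) × Fin M, ∑ l : Fin (N + 1) × Fin M,
        LG.real (validEv (Φ N) τ r k.1 k.2 ∩ validEv (Φ N) τ r l.1 l.2 ∩
          (ordEv (Φ N) r k.1 k.2 l.1 l.2)ᶜ ∩ (ordEv (Φ N) r l.1 l.2 k.1 k.2)ᶜ) :=
    hPE (Phase N) inferInstance LG (Fin (N + 1) × Fin M)
      (fun k => pastSA (Φ N) r k.1 k.2) (fun k l => pairSA (Φ N) r g k.1 k.2 l.1 l.2)
      (fun k => D k.1 k.2) (fun k => w k.1 k.2) (fun k => validEv (Φ N) τ r k.1 k.2)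
      (fun k l => ordEv (Φ N) r k.1 k.2 l.1 l.2) (2 * C) (by positivity)
      (fun k => pastSA_le (Φ N) r k.1 k.2) (fun k l => pairSA_le (Φ N) r hg k.1 k.2 l.1 l.2)
      (fun k l => pastSA_le_pairSA_left (Φ N) r g k.1 k.2 l.1 l.2)
      (fun k l => pastSA_le_pairSA_right (Φ N) r g k.1 k.2 l.1 l.2)
      (fun k l => stronglyMeasurable_kickDev_pairSA (Φ N) r g k.1 k.2 l.1 l.2)
      (fun k => haeD.mono fun z hz => hz k.1 k.2)
      (fun k => stronglyMeasurable_wt (Φ N) r τ hhm k.1 k.2)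
      (fun k => measurableSet_validEv (Φ N) r τ k.1 k.2)
      (fun k z => abs_wt_le (Φ N) r τ hhb k.1 k.2 z)
      (fun k l => measurableSet_ordEv (Φ N) r g k.1 k.2 l.1 l.2)
      (fun k l => measurableSet_ordEv_swap (Φ N) r g k.1 k.2 l.1 l.2)
  set X : ℝ := ∑ k : Fin (N + 1) × Fin M, ∑ l : Fin (N + 1) × Fin M,
        (∫ z, (validEv (Φ N) τ r k.1 k.2 ∩ validEv (Φ N) τ r l.1 l.2 ∩ ordEv (Φ N) r k.1 k.2 l.1 l.2).indicator
            (fun _ => (1 : ℝ)) z * |β₂ k.1 k.2 l.1 l.2 z - β l.1 l.2 z| ∂LG) with hX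
  set Y : ℝ := ∑ k : Fin (N + 1) × Fin M, ∑ l : Fin (N + 1) × Fin M,
        LG.real (validEv (Φ N) τ r k.1 k.2 ∩ validEv (Φ N) τ r l.1 l.2 ∩
          (ordEv (Φ N) r k.1 k.2 l.1 l.2)ᶜ ∩ (ordEv (Φ N) r l.1 l.2 k.1 k.2)ᶜ) with hY
  -- Step 2: integrability of the family sum
  have hSfm : Measurable Sf := Finset.measurable_sum _ fun k _ => (measurable_wt (Φ N) τ r hhm k.1 k.2).mul
    ((measurable_kickDev (Φ N) r hg k.1 k.2).sub (measurable_betaLG_borel (Φ N) r g k.1 k.2))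
  have hSfb : ∀ᵐ z ∂LG, |Sf z| ≤ ∑ _k : Fin (N + 1) × Fin M, 4 * C := by
    filter_upwards [haeD, haeβ] with z hDz hβz
    refine (Finset.abs_sum_le_sum_abs _ _).trans (Finset.sum_le_sum fun k _ => ?_)
    rw [abs_mul]
    calc |w k.1 k.2 z| * |D k.1 k.2 z - β k.1 k.2 z| ≤ 1 * (2 * C + 2 * C) :=
          mul_le_mul (abs_wt_le_one (Φ N) τ r hhb k.1 k.2 z)
            ((abs_sub _ _).trans (add_le_add (hDz k.1 k.2) (hβz k.1 k.2))) (abs_nonneg _) zero_le_one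
      _ = 4 * C := by ring
  have hSfi : Integrable Sf LG := integrable_of_ae_abs_le hSfm.aestronglyMeasurable hSfb
  have hSf2i : Integrable (fun z => Sf z ^ 2) LG := by
    refine integrable_of_ae_abs_le (hSfm.pow_const 2).aestronglyMeasurable
      (B := (∑ _k : Fin (N + 1) × Fin M, 4 * C) ^ 2) (hSfb.mono fun z hz => ?_)
    rw [abs_pow]
    exact pow_le_pow_left₀ (abs_nonneg _) hz 2
  -- Step 3: the ordered pairs, `c² X ≤ δ₂` (B2′)
  have hSm : ∀ k l : Fin (N + 1) × Fin M, MeasurableSet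
      (validEv (Φ N) τ r k.1 k.2 ∩ validEv (Φ N) τ r l.1 l.2 ∩ ordEv (Φ N) r k.1 k.2 l.1 l.2) := fun k l =>
    ((measurableSet_validEv_borel (Φ N) τ r k.1 k.2).inter (measurableSet_validEv_borel (Φ N) τ r l.1 l.2)).inter
      (measurableSet_ordEv_borel (Φ N) r hg k.1 k.2 l.1 l.2)
  have hTi : ∀ k l : Fin (N + 1) × Fin M, Integrable (fun z =>
      (validEv (Φ N) τ r k.1 k.2 ∩ validEv (Φ N) τ r l.1 l.2 ∩ ordEv (Φ N) r k.1 k.2 l.1 l.2).indicator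
        (fun _ => (1 : ℝ)) z * |β₂ k.1 k.2 l.1 l.2 z - β l.1 l.2 z|) LG := by
    intro k l
    refine integrable_of_ae_abs_le (((measurable_const.indicator (hSm k l)).mul
      ((measurable_betaLG2 (Φ N) r hg k.1 k.2 l.1 l.2).sub
        (measurable_betaLG_borel (Φ N) r g l.1 l.2)).abs).aestronglyMeasurable) (B := 1 * (2 * C + 2 * C)) ?_
    filter_upwards [haeβ, haeβ₂] with z h1 h2
    rw [abs_mul, abs_abs, abs_of_nonneg (Set.indicator_nonneg (fun _ _ => zero_le_one) _)]
    exact mul_le_mul (Set.indicator_le_self' (fun _ _ => zero_le_one) z)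
      ((abs_sub _ _).trans (add_le_add (h2 k.1 k.2 l.1 l.2) (h1 l.1 l.2))) (abs_nonneg _) zero_le_one
  have hXb : c ^ 2 * X ≤ δ₂ := by
    have hFi : Integrable (fun z => c ^ 2 * ∑ k : Fin (N + 1) × Fin M, ∑ l : Fin (N + 1) × Fin M,
        (validEv (Φ N) τ r k.1 k.2 ∩ validEv (Φ N) τ r l.1 l.2 ∩ ordEv (Φ N) r k.1 k.2 l.1 l.2).indicator
          (fun _ => (1 : ℝ)) z * |β₂ k.1 k.2 l.1 l.2 z - β l.1 l.2 z|) LG :=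
      (integrable_finsetSum _ fun k _ => integrable_finsetSum _ fun l _ => hTi k l).const_mul _
    have hXeq : c ^ 2 * X = ∫ z, c ^ 2 * ∑ k : Fin (N + 1) × Fin M, ∑ l : Fin (N + 1) × Fin M,
        (validEv (Φ N) τ r k.1 k.2 ∩ validEv (Φ N) τ r l.1 l.2 ∩ ordEv (Φ N) r k.1 k.2 l.1 l.2).indicator
          (fun _ => (1 : ℝ)) z * |β₂ k.1 k.2 l.1 l.2 z - β l.1 l.2 z| ∂LG := by
      rw [integral_const_mul, integral_finsetSum _ fun k _ => integrable_finsetSum _ fun l _ => hTi k l, hX]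
      exact congrArg _ (Finset.sum_congr rfl fun k _ => (integral_finsetSum _ fun l _ => hTi k l).symm)
    rw [hXeq]
    refine integral_le_of_lintegral_ofReal_le (ae_of_all _ fun z => ?_) hFi.aestronglyMeasurable
      (haecut.mono fun z hz => ?_) hB2N hδ₂0.le
    · exact mul_nonneg (sq_nonneg _) (Finset.sum_nonneg fun k _ => Finset.sum_nonneg fun l _ =>
        mul_nonneg (Set.indicator_nonneg (fun _ _ => zero_le_one) _) (abs_nonneg _))
    · exact mul_le_mul_of_nonneg_left (pairSum_ordered_le (Φ N) τ r g M hz) (sq_nonneg _)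
  -- Step 4: the unordered pairs, `c² Y ≤ δb` (CT-b)
  have hS'm : ∀ k l : Fin (N + 1) × Fin M, MeasurableSet (validEv (Φ N) τ r k.1 k.2 ∩ validEv (Φ N) τ r l.1 l.2 ∩
      (ordEv (Φ N) r k.1 k.2 l.1 l.2)ᶜ ∩ (ordEv (Φ N) r l.1 l.2 k.1 k.2)ᶜ) := fun k l =>
    (((measurableSet_validEv_borel (Φ N) τ r k.1 k.2).inter (measurableSet_validEv_borel (Φ N) τ r l.1 l.2)).inter
      (measurableSet_ordEv_borel (Φ N) r hg k.1 k.2 l.1 l.2).compl).inter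
        (measurableSet_ordEv_borel (Φ N) r hg l.1 l.2 k.1 k.2).compl
  have hT'i : ∀ k l : Fin (N + 1) × Fin M, Integrable (fun z => (validEv (Φ N) τ r k.1 k.2 ∩
      validEv (Φ N) τ r l.1 l.2 ∩ (ordEv (Φ N) r k.1 k.2 l.1 l.2)ᶜ ∩ (ordEv (Φ N) r l.1 l.2 k.1 k.2)ᶜ).indicator
        (fun _ => (1 : ℝ)) z) LG := fun k l => (integrable_const _).indicator (hS'm k l)
  have hYb : c ^ 2 * Y ≤ δb := by
    have hFi : Integrable (fun z => c ^ 2 * ∑ k : Fin (N + 1) × Fin M, ∑ l : Fin (N + 1) × Fin M,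
        (validEv (Φ N) τ r k.1 k.2 ∩ validEv (Φ N) τ r l.1 l.2 ∩ (ordEv (Φ N) r k.1 k.2 l.1 l.2)ᶜ ∩
          (ordEv (Φ N) r l.1 l.2 k.1 k.2)ᶜ).indicator (fun _ => (1 : ℝ)) z) LG :=
      (integrable_finsetSum _ fun k _ => integrable_finsetSum _ fun l _ => hT'i k l).const_mul _
    have hYeq : c ^ 2 * Y = ∫ z, c ^ 2 * ∑ k : Fin (N + 1) × Fin M, ∑ l : Fin (N + 1) × Fin M,
        (validEv (Φ N) τ r k.1 k.2 ∩ validEv (Φ N) τ r l.1 l.2 ∩ (ordEv (Φ N) r k.1 k.2 l.1 l.2)ᶜ ∩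
          (ordEv (Φ N) r l.1 l.2 k.1 k.2)ᶜ).indicator (fun _ => (1 : ℝ)) z ∂LG := by
      rw [integral_const_mul, integral_finsetSum _ fun k _ => integrable_finsetSum _ fun l _ => hT'i k l, hY]
      refine congrArg _ (Finset.sum_congr rfl fun k _ => ?_)
      rw [integral_finsetSum _ fun l _ => hT'i k l]
      exact Finset.sum_congr rfl fun l _ => by rw [integral_indicator_const _ (hS'm k l), smul_eq_mul, mul_one]
    rw [hYeq]
    refine integral_le_of_lintegral_ofReal_le (ae_of_all _ fun z => ?_) hFi.aestronglyMeasurable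
      (haecut.mono fun z hz => ?_) hCbN hδb0.le
    · exact mul_nonneg (sq_nonneg _) (Finset.sum_nonneg fun k _ => Finset.sum_nonneg fun l _ =>
        Set.indicator_nonneg (fun _ _ => zero_le_one) _)
    · exact mul_le_mul_of_nonneg_left (pairSum_unordered_le (Φ N) τ r M hz) (sq_nonneg _)
  -- Step 5: Cauchy–Schwarz and the conclusion `c ∫ |Sf| ≤ δ`
  have hI0 : 0 ≤ ∫ z, |Sf z| ∂LG := integral_nonneg fun z => abs_nonneg _
  have hmain : c * ∫ z, |Sf z| ∂LG ≤ δ := by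
    refine (pow_le_pow_iff_left₀ (mul_nonneg hc0 hI0) hδ.le two_ne_zero).1 ?_
    calc (c * ∫ z, |Sf z| ∂LG) ^ 2 = c ^ 2 * (∫ z, |Sf z| ∂LG) ^ 2 := by ring
      _ ≤ c ^ 2 * ∫ z, Sf z ^ 2 ∂LG :=
          mul_le_mul_of_nonneg_left (sq_integral_abs_le_integral_sq hSfi hSf2i) (sq_nonneg _)
      _ ≤ c ^ 2 * (4 * (2 * C) * X + 4 * (2 * C) ^ 2 * Y) := mul_le_mul_of_nonneg_left hPEapp (sq_nonneg _)
      _ = 4 * (2 * C) * (c ^ 2 * X) + 4 * (2 * C) ^ 2 * (c ^ 2 * Y) := by ring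
      _ ≤ 4 * (2 * C) * δ₂ + 4 * (2 * C) ^ 2 * δb :=
          add_le_add (mul_le_mul_of_nonneg_left hXb (by positivity)) (mul_le_mul_of_nonneg_left hYb (by positivity))
      _ ≤ δ ^ 2 := targets_le_sq hC0
  -- Step 6: back to the `lintegral` statement through `truncSum_ae_eq`
  have hcI : Integrable (fun z => c * |Sf z|) LG := hSfi.abs.const_mul c
  refine (lintegral_congr_ae (g := fun z => ENNReal.ofReal (c * |Sf z|)) ?_).trans_le ?_
  · filter_upwards [truncSum_ae_eq σ N a₀ θ₀ u₀ hσ2 (Φ N) τ r g A h] with z hz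
    rw [hz, abs_mul, abs_of_nonneg hc0]
  · show ∫⁻ z, ENNReal.ofReal (c * |Sf z|) ∂LG ≤ ENNReal.ofReal δ
    rw [← ofReal_integral_eq_lintegral_ofReal hcI (ae_of_all _ fun z => mul_nonneg hc0 (abs_nonneg _))]
    refine ENNReal.ofReal_le_ofReal ?_
    rw [integral_const_mul]
    exact hmain

end Main

end Summit.AtomisticToContinuum.HydrodynamicLimit.Theorems.KickFairRelEquilibriumMesoLine

end
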